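import Mathlib
import Summits.QuantumFields.YangMills.Theorems.TransportFieldFanoVacuumConcentrationRpow
import Summits.QuantumFields.YangMills.Theorems.TransportFieldFanoVacuumConcentrationLayersArith
import HarnessLib

/-!
# The fixed-torus rung of `MeanLoopCeilingWeak` BY ITS LETTERS from ONE named missing input: the valley gain at radius `β^{−1/4}`
# (route `TransportFieldFano`, LINE g17-A, crux ⟨stmt-QuantumFields-23353⟩ helper lane; sequel to ✓`…VacuumConcentrationRpow`)

✓`VacuumConc.vacuum_torelon_mean_le_rpow` gives `E_{Ω²}[F] ≤ (18L²+4)·β^{−2p}` for every `p < 1/5`, the range of S-BASE lane A's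
✓`TwoLattice.ConstTube.valleyGain_record`; the registered BC5 rung `stub_rung_fixedTorus` of ⟨23353⟩ asks `β^{−1/2}`.  THIS FILE is the
kernel-checked CLOSING RECIPE: the rung's letters follow, at EVERY `L₀ ≥ 2`, from the single hypothesis

  `ValleyGainAt L₀ (powScale (1/4)) (powScale (17/20))`

(RED's valley-gain text at the radius `β^{−1/4}`; lane A's thin shells stop at exponents `< 1/5`, the InnerTwoZone design note expects the
C4-SHELL gain at every core exponent `< 1/3`).  Mechanism: THREE onion layers (✓`GroundConc.layer_mass_le` at `ρ, 3ρ, 9ρ`, `ρ = β^{−1/4}`), each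
costing `≍ ρ^{−2}β^{−1}/λ_b(L³β) ≍ β^{−1/6}` relative to the previous layer's mass, so the vacuum mass outside the `9ρ`-windows is
`≤ C·β^{−1/2}‖Ω‖²`; inside, Polyakov pinning gives `F ≤ 2(9Lρ)² = 162L²β^{−1/2}` (✓`l2_torelon_mul_vacuum_le_inner_outer`).
* arithmetic in the companion ✓`…VacuumConcentrationLayersArith` (`three_layer_arith_gen`, `endgame_real_layers`);
* §3 ★★ `groundState_outer_mass_le_of_valleyGain_quarter` — `ValleyGainAt L (β^{−1/4}) (β^{−17/20}) ⇒ ‖sin Θ_{9β^{−1/4}}·Ω‖² ≤ C·β^{−1/2}·‖Ω‖²`;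
* §4 ★★ `vacuum_torelon_mean_le_of_valleyGain_quarter` — `⇒ E_{Ω²}[F] ≤ (162L² + 4C)·β^{−1/2}`;
* §5 ★★ `fixedTorusRung_of_valleyGain_quarter` — `⇒` the registered rung's letters verbatim (exponent `−1/2`, `L₀ := L`).
HONEST FRAMING: a CONDITIONAL fixed-lattice helper (`--supports 23353`); the hypothesis is OPEN in the tree (named above, lane-A / fibred-BO class);
no registered stub is closed by name; nothing about infinite volume, the continuum or the Yang–Mills mass gap; no summit statement.
No `sorry`, no new definition, no named-fact `def`.
References: [cite: SimonB1983DiscreteSpectrum, §3]; [cite: Luscher1983, §2–3]; [cite: LuscherMunster1984, §2].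
-/

set_option autoImplicit false

noncomputable section

open MeasureTheory Filter Topology Real
open scoped Matrix BigOperators
open Literature.MathematicalPhysics.QuantumFieldTheory hiding SU2
open Literature.MathematicalPhysics.QuantumLattice

namespace Summit.QuantumFields.YangMills.Theorems.TransportFieldFano

namespace VacuumConc

open Summit.QuantumFields.YangMills.Theorems.FemtoTransferGap
open Summit.QuantumFields.YangMills.Theorems.FemtoTransferGap.OffTube
open Summit.QuantumFields.YangMills.Theorems.FemtoTransferGap.GroundConc
open Summit.QuantumFields.YangMills.Theorems.FemtoCutoffLadder

variable {L : ℕ} [NeZero L]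

/-! ## §3 Concentration at radius `9β^{−1/4}` from the valley gain at `β^{−1/4}` -/

set_option maxHeartbeats 1600000 in
/-- ★★ **CONCENTRATION AT RADIUS `β^{−1/4}` FROM THE VALLEY GAIN THERE** (`L ≥ 2`): if `ValleyGainAt L (β^{−1/4}) (β^{−17/20})` holds, then for
some `C = C(L)` and all `β ≥ β₀(L)`, every physical `Ω` with `K_βΩ = λ₀Ω` has `‖sin Θ_{9β^{−1/4}}·Ω‖² ≤ C·β^{−1/2}·‖Ω‖²`.  Three onion layers
(✓`GroundConc.layer_mass_le` at `ρ, 3ρ, 9ρ`). [cite: SimonB1983DiscreteSpectrum, §3] [cite: Luscher1983, §2–3] -/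
theorem groundState_outer_mass_le_of_valleyGain_quarter (hL : 2 ≤ L)
    (hV0 : ValleyGainAt L (powScale (1 / 4)) (powScale (17 / 20))) :
    ∃ C : ℝ, 0 < C ∧ ∃ β0 : ℝ, ∀ β : ℝ, β0 ≤ β → ∀ Ω : GaugeConfig 3 L SU2 → ℝ, IsPhys Ω →
      transferApply β Ω = topValue su2Rep L β • Ω →
      l2 (fun U => Real.sin (innerPhase (9 * powScale (1 / 4) β) U) * Ω U)
          (fun U => Real.sin (innerPhase (9 * powScale (1 / 4) β) U) * Ω U) ≤ C * β ^ (-(1 : ℝ) / 2) * l2 Ω Ω := by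
  set p : ℝ := 1 / 4 with hpdef
  have hp0 : 0 < p := by norm_num [hpdef]
  have hL0 : (0 : ℝ) < L := by exact_mod_cast Nat.pos_of_ne_zero (NeZero.ne L)
  have hL3 : (8 : ℝ) ≤ (L : ℝ) ^ 3 := by
    have h2 : (2 : ℝ) ≤ L := by exact_mod_cast hL
    have h := pow_le_pow_left₀ (by norm_num : (0 : ℝ) ≤ 2) h2 3
    norm_num at h
    exact h
  set n : ℕ := Fintype.card (Edge 3 L) with hn
  have hn0 : (0 : ℝ) < n := by rw [hn]; exact_mod_cast Fintype.card_pos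
  set f : ℝ := uniformFloorConst L with hf
  have hf0 : 0 < f := uniformFloorConst_pos (L := L)
  set w : ℝ := Real.exp (-(1 / 2 : ℝ)) * (8 / (3 * π ^ 3)) with hw
  have hw0 : 0 < w := by positivity
  -- the HYPOTHESISED valley gain at radius `β^{−1/4}`, `A = 1`
  obtain ⟨βV, hV⟩ := hV0 1
  -- constants and thresholds
  set cL : ℝ := (2 / (L : ℝ) ^ 3) ^ ((1 : ℝ) / 3) with hcL
  have hcL0 : 0 < cL := by positivity
  have ha2 : 0 < 2 / 3 - 2 * p := by norm_num [hpdef]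
  have hs3 : 0 < 1 - 2 * p := by norm_num [hpdef]
  set K₀ : ℝ := 6 * (n : ℝ) ^ 2 * (8 * π) ^ 2 / f with hK₀
  have hK₀0 : 0 < K₀ := by positivity
  obtain ⟨β1, h1⟩ := eventually_rpow_dominates (a := 2 / 3 - 2 * p) (b := 0) (k := 0) (C := (0 : ℝ)) ha2 ha2
  obtain ⟨β2, h2⟩ := eventually_rpow_dominates (a := 2 / 3 - 2 * p) (b := 0) (k := 0)
    (C := (6 * (n : ℝ) ^ 2 * (8 * π) ^ 2 / f) / cL) ha2 ha2
  obtain ⟨β3, h3⟩ := superpoly_small (16 * (4 * (L : ℝ) ^ 3 / f) * (4 / w) ^ n) (2 * n + 2) (c := 1 / (8 * n)) (s := 1 - 2 * p) (ε := 1)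
    (by positivity) hs3 one_pos
  obtain ⟨β4, h4⟩ := superpoly_small (16 * (4 * (L : ℝ) ^ 3 / f) * (1 + 4 * (L : ℝ) ^ 3)) 3 (c := 1) (s := 3 / 20) (ε := 1)
    one_pos (by norm_num) one_pos
  obtain ⟨β5, h5⟩ := superpoly_small (16 / f) 1 (c := 1) (s := 3 / 20) (ε := 1) one_pos (by norm_num) one_pos
  refine ⟨2 * (K₀ / cL) ^ 3 + 18, by positivity, max βV (max β1 (max β2 (max β3 (max β4 β5)))), fun β hβ Ω hΩ heig => ?_⟩
  have hβV : βV ≤ β := (le_max_left _ _).trans hβ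
  obtain ⟨hβ1, -⟩ := h1 β ((le_max_left _ _).trans ((le_max_right _ _).trans hβ))
  obtain ⟨-, h2β⟩ := h2 β ((le_max_left _ _).trans ((le_max_right _ _).trans ((le_max_right _ _).trans hβ)))
  obtain ⟨-, h3β⟩ := h3 β ((le_max_left _ _).trans ((le_max_right _ _).trans ((le_max_right _ _).trans ((le_max_right _ _).trans hβ))))
  obtain ⟨-, h4β⟩ := h4 β ((le_max_left _ _).trans ((le_max_right _ _).trans ((le_max_right _ _).trans
    ((le_max_right _ _).trans ((le_max_right _ _).trans hβ)))))
  obtain ⟨-, h5β⟩ := h5 β ((le_max_right _ _).trans ((le_max_right _ _).trans ((le_max_right _ _).trans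
    ((le_max_right _ _).trans ((le_max_right _ _).trans hβ)))))
  clear h1 h2 h3 h4 h5
  simp only [zero_mul, add_zero, Real.rpow_zero, mul_one] at h2β
  simp only [one_mul, pow_one] at h4β h5β
  have hβ0 : 0 < β := by linarith
  -- the scales
  set ρ : ℝ := powScale p β with hρdef
  have hρ : ρ = β ^ (-p) := powScale_eq hβ1
  have hρ0 : 0 < ρ := powScale_pos _ _
  have h3ρ0 : 0 < 3 * ρ := by positivity
  have h9ρ0 : 0 < 9 * ρ := by positivity
  set η : ℝ := powScale (17 / 20) β with hηdef
  have hη : η = β ^ (-(17 / 20 : ℝ)) := powScale_eq hβ1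
  have hη0 : 0 < η := powScale_pos _ _
  set u : ℝ := bareLambda ((L : ℝ) ^ 3 * β) with hudef
  have hB2 : 2 ≤ (L : ℝ) ^ 3 * β := by nlinarith
  have hu01 := bareLambda_pos_le_one hB2
  have hu0 : 0 < u := hu01.1
  have hu1 : u ≤ 1 := hu01.2
  have hu : u = cL * β ^ (-(1 : ℝ) / 3) := bareLambda_cube_eq (L := L) hβ0
  have hinvu : 1 / u ≤ (L : ℝ) ^ 3 * β := by
    have hx0 : 0 < 2 / ((L : ℝ) ^ 3 * β) := by positivity
    have hx1 : 2 / ((L : ℝ) ^ 3 * β) ≤ 1 := by rw [div_le_one (by positivity)]; linarith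
    have hux : 2 / ((L : ℝ) ^ 3 * β) ≤ u := by
      have h := Real.rpow_le_rpow_of_exponent_ge hx0 hx1 (show (1 : ℝ) / 3 ≤ 1 by norm_num)
      rw [Real.rpow_one] at h
      exact h
    have h1 : 1 / u ≤ 1 / (2 / ((L : ℝ) ^ 3 * β)) := one_div_le_one_div_of_le hx0 hux
    rw [one_div_div] at h1
    have h3 : (L : ℝ) ^ 3 * β / 2 ≤ (L : ℝ) ^ 3 * β := by
      have : 0 ≤ (L : ℝ) ^ 3 * β := by positivity
      linarith
    exact h1.trans h3
  set γ : ℝ := 1 - Real.exp (-u) with hγdef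
  have hγu : u / 2 ≤ γ := by
    have h1 : 1 + u ≤ Real.exp u := by have := Real.add_one_le_exp u; linarith
    have h2 : Real.exp (-u) * Real.exp u = 1 := by rw [← Real.exp_add]; simp
    have h3 : 0 < Real.exp (-u) := Real.exp_pos _
    have h4 : Real.exp (-u) * (1 + u) ≤ 1 := by nlinarith
    rw [hγdef]; nlinarith
  have hγ0 : 0 < γ := by linarith
  set lam : ℝ := topValue su2Rep L β with hlam
  have hlam0 : 0 < lam := topValue_su2Rep_pos L β
  have hlat0 : 0 < latCE L β := latCE_pos (L := L) hβ0.le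
  have hlamf : f * latCE L β ≤ lam := by
    have h := levelValue_zero_ge_uniform (L := L) hβ1
    rwa [levelValue_zero] at h
  -- the GAIN on tube states away from the `r`-neighbourhoods, `r ≥ ρ`
  have hgain : ∀ r : ℝ, 0 < r → ρ ≤ r → ∀ φ : GaugeConfig 3 L SU2 → ℝ, IsPhys φ →
      (∀ U, φ U ≠ 0 → wilsonAction su2Rep U ≤ η ∧ Real.sin (innerPhase r U) ≠ 0) →
      qform su2Rep β φ φ ≤ (1 - γ) * lam * l2 φ φ := by
    intro r hr0 hr φ hφ hsupp
    have h := hV β hβV φ hφ (fun U hU => ?_)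
    · have e : (1 - γ) * lam = Real.exp (-(1 * u)) * levelValue su2Rep L β 0 := by
        rw [levelValue_zero, hγdef, one_mul]; ring
      rw [e]; exact h
    · obtain ⟨hS, hsin⟩ := hsupp U hU
      refine ⟨by linarith, fun z => ?_⟩
      have := forall_lt_orbitDist_of_sin_ne_zero hr0 hsin z
      linarith
  -- cut-off bookkeeping for `sin Θ_r`
  have hsm : ∀ r : ℝ, Measurable fun U : GaugeConfig 3 L SU2 => Real.sin (innerPhase r U) :=
    fun r => Real.continuous_sin.measurable.comp (measurable_innerPhase r)
  have hsb : ∀ (r : ℝ) (U : GaugeConfig 3 L SU2), |Real.sin (innerPhase r U)| ≤ 1 := fun r U => Real.abs_sin_le_one _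
  have hsg : ∀ (r : ℝ) (k : Site 3 L → SU2) (U : GaugeConfig 3 L SU2),
      Real.sin (innerPhase r (gaugeTransform k U)) = Real.sin (innerPhase r U) := fun r k U => by rw [innerPhase_gaugeTransform]
  have hsz : ∀ (r : ℝ) (k : Fin 3), ∀ z ∈ Subgroup.center SU2, ∀ U : GaugeConfig 3 L SU2,
      Real.sin (innerPhase r (twist k z U)) = Real.sin (innerPhase r U) := fun r k z hz U => by rw [innerPhase_twist r k hz]
  have hsLip : ∀ r : ℝ, 0 < r → ∀ U V : GaugeConfig 3 L SU2,
      |Real.sin (innerPhase r U) - Real.sin (innerPhase r V)| ≤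
        (8 * π / r) * ∑ e, frobNorm ((U e : Matrix (Fin 2) (Fin 2) ℂ) - (V e : Matrix (Fin 2) (Fin 2) ℂ)) :=
    fun r hr U V => (Real.abs_sin_sub_sin_le _ _).trans (abs_innerPhase_sub_le hr U V)
  have hs0 : ∀ (r : ℝ) (U : GaugeConfig 3 L SU2), 0 ≤ Real.sin (innerPhase r U) := fun r U =>
    Real.sin_nonneg_of_nonneg_of_le_pi (innerPhase_mem r U).1 ((innerPhase_mem r U).2.trans (by linarith [Real.pi_pos]))
  have hs1 : ∀ (r : ℝ) (U : GaugeConfig 3 L SU2), Real.sin (innerPhase r U) ≤ 1 := fun r U => Real.sin_le_one _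
  -- LAYER 1: `g = sin Θ_ρ`, `g₁ = 1`
  have hL1 := layer_mass_le hβ0 hΩ heig (g := fun U => Real.sin (innerPhase ρ U)) (g₁ := fun _ => (1 : ℝ))
    (hsm ρ) (hsb ρ) (hsg ρ) (hsz ρ) (Λ := 8 * π / ρ) (hsLip ρ hρ0) measurable_const (fun _ => zero_le_one) (fun _ => le_rfl)
    (fun _ _ => rfl) (fun _ _ _ _ => rfl) (fun _ _ => rfl) (R := ρ / 2) (by positivity) (fun _ _ _ h => absurd rfl h) η hγ0
    (hgain ρ hρ0 le_rfl)
  have e1 : (fun U : GaugeConfig 3 L SU2 => (1 : ℝ) * Ω U) = Ω := by funext U; ring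
  rw [e1] at hL1
  -- LAYER 2: `g = sin Θ_{3ρ}`, `g₁ = sin Θ_ρ`, separation `ρ/2`
  have hgg₁ : ∀ U : GaugeConfig 3 L SU2, Real.sin (innerPhase (3 * ρ) U) ≠ 0 → Real.sin (innerPhase ρ U) = 1 := fun U hU =>
    sin_innerPhase_eq_one_of_sin_ne_zero h3ρ0 hρ0 (by linarith) hU
  have hloc : ∀ U V : GaugeConfig 3 L SU2, Real.sin (innerPhase (3 * ρ) U) ≠ 0 → Real.sin (innerPhase ρ V) ≠ 1 →
      ρ / 2 ≤ ∑ e : Edge 3 L, frobNorm (((U e : SU2) : Matrix (Fin 2) (Fin 2) ℂ) - ((V e : SU2) : Matrix (Fin 2) (Fin 2) ℂ)) := by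
    intro U V hU hV1
    have hU' := forall_lt_orbitDist_of_sin_ne_zero h3ρ0 hU
    have hV' : ∃ z : Fin 3 → Bool, orbitDist (TT.twist3 z V) < ρ := by
      by_contra h
      push Not at h
      exact hV1 (sin_innerPhase_eq_one hρ0 h)
    have h := sum_frobNorm_ge_of_orbitDist hU' hV'
    linarith
  have hL2 := layer_mass_le hβ0 hΩ heig (g := fun U => Real.sin (innerPhase (3 * ρ) U)) (g₁ := fun U => Real.sin (innerPhase ρ U))
    (hsm (3 * ρ)) (hsb (3 * ρ)) (hsg (3 * ρ)) (hsz (3 * ρ)) (Λ := 8 * π / (3 * ρ)) (hsLip (3 * ρ) h3ρ0) (hsm ρ) (hs0 ρ) (hs1 ρ)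
    (hsg ρ) (hsz ρ) hgg₁ (R := ρ / 2) (by positivity) hloc η hγ0 (hgain (3 * ρ) h3ρ0 (by linarith))
  -- LAYER 3: `g = sin Θ_{9ρ}`, `g₁ = sin Θ_{3ρ}`, separation `ρ/2`
  have hgg₂ : ∀ U : GaugeConfig 3 L SU2, Real.sin (innerPhase (9 * ρ) U) ≠ 0 → Real.sin (innerPhase (3 * ρ) U) = 1 := fun U hU =>
    sin_innerPhase_eq_one_of_sin_ne_zero h9ρ0 h3ρ0 (by linarith) hU
  have hloc₂ : ∀ U V : GaugeConfig 3 L SU2, Real.sin (innerPhase (9 * ρ) U) ≠ 0 → Real.sin (innerPhase (3 * ρ) V) ≠ 1 →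
      ρ / 2 ≤ ∑ e : Edge 3 L, frobNorm (((U e : SU2) : Matrix (Fin 2) (Fin 2) ℂ) - ((V e : SU2) : Matrix (Fin 2) (Fin 2) ℂ)) := by
    intro U V hU hV1
    have hU' := forall_lt_orbitDist_of_sin_ne_zero h9ρ0 hU
    have hV' : ∃ z : Fin 3 → Bool, orbitDist (TT.twist3 z V) < 3 * ρ := by
      by_contra h
      push Not at h
      exact hV1 (sin_innerPhase_eq_one h3ρ0 h)
    have h := sum_frobNorm_ge_of_orbitDist hU' hV'
    linarith
  have hL3' := layer_mass_le hβ0 hΩ heig (g := fun U => Real.sin (innerPhase (9 * ρ) U)) (g₁ := fun U => Real.sin (innerPhase (3 * ρ) U))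
    (hsm (9 * ρ)) (hsb (9 * ρ)) (hsg (9 * ρ)) (hsz (9 * ρ)) (Λ := 8 * π / (9 * ρ)) (hsLip (9 * ρ) h9ρ0) (hsm (3 * ρ)) (hs0 (3 * ρ))
    (hs1 (3 * ρ)) (hsg (3 * ρ)) (hsz (3 * ρ)) hgg₂ (R := ρ / 2) (by positivity) hloc₂ η hγ0 (hgain (9 * ρ) h9ρ0 (by linarith))
  clear hV hgain hsm hsb hsg hsz hsLip hs0 hs1 hgg₁ hloc hgg₂ hloc₂ e1
  -- the cross-copy bound in polynomial × stretched-exponential form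
  have hββ : ∀ x : ℝ, β * β ^ x = β ^ (1 + x) := fun x => by rw [Real.rpow_add hβ0, Real.rpow_one]
  have hexp1 : β / 2 * ((ρ / 2) ^ 2 / n) = 1 / (8 * n) * β ^ (1 - 2 * p) := by
    rw [hρ]
    have e : (β ^ (-p) / 2) ^ 2 = β ^ (-p * (2 : ℕ)) / 4 := by
      rw [div_pow, ← Real.rpow_mul_natCast hβ0.le]; norm_num
    rw [e]
    have e2 : β * β ^ (-p * (2 : ℕ)) = β ^ (1 - 2 * p) := by
      rw [hββ]; congr 1; push_cast; ring
    rw [← e2]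
    field_simp
    ring
  have hcb_le : crossBound L β (ρ / 2) ≤
      (4 / w) ^ n * β ^ (2 * n) * Real.exp (-(1 / (8 * n) * β ^ (1 - 2 * p))) * latCE L β := by
    have h := crossBound_le_poly_latCE (L := L) hβ1 (ρ / 2)
    rw [← hn, hexp1] at h
    have e : (4 * β ^ 2 / (Real.exp (-(1 / 2 : ℝ)) * (8 / (3 * π ^ 3)))) ^ n = (4 / w) ^ n * β ^ (2 * n) := by
      rw [hw, pow_mul, ← mul_pow]; congr 1; field_simp
    rw [e] at h
    exact h
  -- the endgame
  obtain ⟨hq1, hq2, hq3, hA1, hA0, hcb', hk', ht'⟩ := endgame_real_layers n (lam := lam) (γ := γ) (p := p) hβ1 hn0 hf0 hw0 hlat0 hlamf hu0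
    hcL0 hu (by positivity) hinvu hρ hη hγu (crossBound_pos (L := L) β (ρ / 2)).le hcb_le h2β h3β h4β h5β
  -- `θ = (2(K₀/cL)³ + 18)·β^{−1/2}`
  set θ : ℝ := (2 * (K₀ / cL) ^ 3 + 18) * β ^ (-(1 : ℝ) / 2) with hθdef
  have hb : 0 ≤ β ^ (-(1 : ℝ) / 2) := Real.rpow_nonneg hβ0.le _
  have hK3 : 0 ≤ (K₀ / cL) ^ 3 := pow_nonneg (by positivity) 3
  have hK3b : 0 ≤ (K₀ / cL) ^ 3 * β ^ (-(1 : ℝ) / 2) := mul_nonneg hK3 hb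
  have hA3 : (K₀ / cL * β ^ (-(2 / 3 - 2 * p))) ^ 3 ≤ θ / 2 := by
    have e3 : (β ^ (-(2 / 3 - 2 * p))) ^ 3 = β ^ (-(1 : ℝ) / 2) := by
      rw [← Real.rpow_natCast, ← Real.rpow_mul hβ0.le, hpdef]; norm_num
    rw [mul_pow, e3, hθdef]
    have e4 : (2 * (K₀ / cL) ^ 3 + 18) * β ^ (-(1 : ℝ) / 2) / 2 = (K₀ / cL) ^ 3 * β ^ (-(1 : ℝ) / 2) + 9 * β ^ (-(1 : ℝ) / 2) := by
      ring
    rw [e4]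
    linarith
  have hθβ : 1 / (16 * β) ≤ θ / 18 := by
    have h1 : β ^ (-(1 : ℝ)) ≤ β ^ (-(1 : ℝ) / 2) := Real.rpow_le_rpow_of_exponent_le hβ1 (by norm_num)
    rw [Real.rpow_neg_one] at h1
    have hi : 0 ≤ β⁻¹ := by positivity
    have e : 1 / (16 * β) = β⁻¹ / 16 := by field_simp
    rw [e, hθdef]
    have e2 : (2 * (K₀ / cL) ^ 3 + 18) * β ^ (-(1 : ℝ) / 2) / 18 = (K₀ / cL) ^ 3 * β ^ (-(1 : ℝ) / 2) / 9 + β ^ (-(1 : ℝ) / 2) := by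
      ring
    rw [e2]
    linarith
  have hfin := three_layer_arith_gen (l2_self_nonneg Ω) (by positivity : (0 : ℝ) ≤ 2 / (γ * lam))
    (crossBound_pos (L := L) β (ρ / 2)).le (by positivity) (by positivity) hA0
    (l2_self_nonneg _) (l2_self_nonneg _) hL1 hL2 hL3' hq1 hq2 hq3 hA1 hA3
    (hcb'.trans hθβ) (hk'.trans hθβ) (ht'.trans hθβ)
  simpa only [hρdef, hθdef] using hfin


/-! ## §4 The torelon ceiling at exponent `1/2` from the valley gain at `β^{−1/4}` -/

/-- ★★ **`ValleyGainAt L (β^{−1/4}) (β^{−17/20}) ⇒ E_{Ω²}[F] ≤ C'·β^{−1/2}`** for `β ≥ β₀(L)`, every physical `l2`-normalised exact vacuum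
(split ✓`l2_torelon_mul_vacuum_le_inner_outer` at `δ = 9β^{−1/4}`: inner `2(9L)²β^{−1/2}`, outer `4Cβ^{−1/2}`). [cite: Luscher1983, §2–3]
[cite: SimonB1983DiscreteSpectrum, §3] -/
theorem vacuum_torelon_mean_le_of_valleyGain_quarter (hL : 2 ≤ L)
    (hV0 : ValleyGainAt L (powScale (1 / 4)) (powScale (17 / 20))) :
    ∃ C β₀ : ℝ, ∀ β : ℝ, β₀ ≤ β → ∀ Ω : GaugeConfig 3 L SU2 → ℝ, IsPhys Ω → l2 Ω Ω = 1 →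
      transferApply β Ω = topValue su2Rep L β • Ω →
        l2 (fun U => flowLift 0 (fun u : GaugeConfig 3 1 SU2 => 4 - ((su2Rep (u ((0 : Site 3 1), (0 : Fin 3)))).trace.re) ^ 2) U * Ω U) Ω ≤
          C * β ^ (-(1 : ℝ) / 2) := by
  obtain ⟨C, hC, β0, h0⟩ := groundState_outer_mass_le_of_valleyGain_quarter hL hV0
  refine ⟨2 * ((L : ℝ) * 9) ^ 2 + 4 * C, max β0 1, fun β hβ Ω hΩ hn heig => ?_⟩
  have hβ0 : β0 ≤ β := (le_max_left _ _).trans hβ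
  have hβ1 : 1 ≤ β := (le_max_right _ _).trans hβ
  have hβpos : 0 < β := by linarith
  have hρ : powScale (1 / 4) β = β ^ (-(1 / 4 : ℝ)) := powScale_eq hβ1
  have hδ : 0 < 9 * powScale (1 / 4) β := by have := powScale_pos (1 / 4) β; positivity
  have hsplit := l2_torelon_mul_vacuum_le_inner_outer hδ hΩ
  have hout := h0 β hβ0 Ω hΩ heig
  rw [hn] at hsplit hout
  have hsq : (powScale (1 / 4) β) ^ 2 = β ^ (-(1 : ℝ) / 2) := by
    rw [hρ, ← Real.rpow_natCast, ← Real.rpow_mul hβpos.le]; norm_num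
  have e : 2 * ((L : ℝ) * (9 * powScale (1 / 4) β)) ^ 2 * 1 = 2 * ((L : ℝ) * 9) ^ 2 * β ^ (-(1 : ℝ) / 2) := by
    rw [← hsq]; ring
  rw [e] at hsplit
  have : (2 * ((L : ℝ) * 9) ^ 2 + 4 * C) * β ^ (-(1 : ℝ) / 2) =
      2 * ((L : ℝ) * 9) ^ 2 * β ^ (-(1 : ℝ) / 2) + 4 * (C * β ^ (-(1 : ℝ) / 2) * 1) := by ring
  rw [this]
  linarith

/-! ## §5 The registered rung's letters from the valley gain at `β^{−1/4}` -/

/-- ★★ **CLOSING RECIPE for `stub_rung_fixedTorus` of ⟨23353⟩**: at any `L ≥ 2`, `ValleyGainAt L (β^{−1/4}) (β^{−17/20})` implies the registered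
rung's letters VERBATIM (`L₀ := L`, exponent `−1/2`).  The hypothesis is OPEN (lane A's record valley gain reaches radii `β^{−a}`, `a < 1/5` only).
[cite: Luscher1983, §2–3] [cite: SimonB1983DiscreteSpectrum, §3] -/
theorem fixedTorusRung_of_valleyGain_quarter (hL : 2 ≤ L)
    (hV0 : ValleyGainAt L (powScale (1 / 4)) (powScale (17 / 20))) :
    ∃ L₀ : ℕ, 2 ≤ L₀ ∧ ∃ C β₀ : ℝ, ∀ β : ℝ, β₀ ≤ β → ∀ (L' : ℕ) [NeZero L'], L' = L₀ →
      ∀ Ω : Literature.MathematicalPhysics.QuantumFieldTheory.GaugeConfig 3 L' SU2 → ℝ, IsPhys Ω → l2 Ω Ω = 1 →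
        transferApply β Ω = topValue su2Rep L' β • Ω →
        let F : Literature.MathematicalPhysics.QuantumFieldTheory.GaugeConfig 3 L' SU2 → ℝ :=
          flowLift 0 (fun u : Literature.MathematicalPhysics.QuantumFieldTheory.GaugeConfig 3 1 SU2 =>
            4 - ((su2Rep (u ((0 : Literature.MathematicalPhysics.QuantumFieldTheory.Site 3 1), (0 : Fin 3)))).trace.re) ^ 2)
        l2 (fun U => F U * Ω U) Ω ≤ C * β ^ (-(1 : ℝ) / 2) := by
  obtain ⟨C, β₀, h⟩ := vacuum_torelon_mean_le_of_valleyGain_quarter hL hV0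
  refine ⟨L, hL, C, β₀, fun β hβ L' _ hL' Ω hΩ hn heig => ?_⟩
  subst hL'
  exact h β hβ Ω hΩ hn heig

end VacuumConc

end Summit.QuantumFields.YangMills.Theorems.TransportFieldFano

end
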